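import Summits.CriticalPhenomena.PercolationContinuityZ3.Theorems.PercNearOneGluingNoHeavyLowerTailSunflowerMultiPetalModuleLift
import Summits.CriticalPhenomena.PercolationContinuityZ3.Theorems.PercNearOneGluingNoHeavyLowerTailSunflowerMultiPetalModuleFlip
import HarnessLib
import HarnessLib.Audit

/-!
# `NoHeavyLowerTail` (crux stmt-CriticalPhenomena-4575), abstract sunflower cubic, `k` petals: Conjecture G for every flip set INSIDE a non-bottom module —
# in particular `0 ≤ ZKflip {e}` at EVERY coordinate (white or not) of a structure tiled by non-bottom modules

Support file (seat `prim-l12-p2` gen 33; `--supports stmt-CriticalPhenomena-4575`; companion of `…SunflowerMultiPetalModuleLift` (this gen: one-, two-, three-lift glued sums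
under the one-petal glue hypothesis, `gsum_biUnion_nonneg_of_modules`) and `…SunflowerMultiPetalModuleFlip` (this gen: the flipped module identity `ZKflip_eq_sum_pattern`)).
Everything here is PROVED; no `sorry`.  Memo: run/shared/lean/prim/prim-l12/prim-l12-p2/FINDING-g33-MODULE-LIFT.md §1.9.

If the flip set `D` lies INSIDE the module `M`, the flipped module identity has unflipped lifted sums outside (`D ∖ M = ∅`): only the gadget statistics are flipped.
Under the one-petal glue hypothesis (e.g. `lab M ≠ 0`) all eight lifted sums are nonnegative as soon as ★ₖ holds on the deletion window (`…ModuleLift`), hence: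
* **`ZKflip_nonneg_of_isModule_of_upper_of_subset`**: `(M, g)` module, glued labels in `{0, p, ⊤}`, `D ⊆ M`, `0 ≤ gsum Mᶜ ∅ ∅ ∅` ⟹ `0 ≤ ZKflip D`;
* **`ZKflip_nonneg_of_modules_cover_of_subset`**: if `univ` is a disjoint union of modules `M i` with `lab (M i) ≠ 0` and `D ⊆ M i₀` for one tile, then `0 ≤ ZKflip D` —
  Conjecture G for every flip set inside one territory of a θ_m-blow-up (any `m`, any gadgets), in particular **for every singleton `D = {e}`, `e` arbitrary** (white
  coordinates inside AND-territories included), complementing `…FlipSingleton` (which needs `lab {e} ≠ 0` but no module).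
-/

namespace Summit.CriticalPhenomena.PercolationContinuityZ3.Theorems.SunflowerPartition

open Finset

variable {α : Type*} [DecidableEq α] [Fintype α]

namespace MSunflower

variable {k : ℕ} (F : MSunflower k α)

/-- **Conjecture G for a flip set inside a one-petal module**: if `(M, g)` is a module whose glued labels `lab (X ∪ M)`, `X ⊆ Mᶜ`, lie in `{0, p, ⊤}`, `D ⊆ M`, and ★ₖ holds on
the deletion window (`0 ≤ gsum Mᶜ ∅ ∅ ∅`), then `0 ≤ ZKflip D`. [this work] -/
theorem ZKflip_nonneg_of_isModule_of_upper_of_subset {M : Finset α} {g : Finset α → Bool} (hF : F.IsModule M g) (p : Fin (k + 2))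
    (hup : ∀ X ⊆ Mᶜ, F.lab (X ∪ M) = 0 ∨ F.lab (X ∪ M) = p ∨ F.lab (X ∪ M) = Fin.last (k + 1))
    {D : Finset α} (hD : D ⊆ M) (h0 : 0 ≤ F.gsum Mᶜ ∅ ∅ ∅) : 0 ≤ F.ZKflip D := by
  have hDM : D \ M = ∅ := sdiff_eq_empty_iff_subset.2 hD
  have h1 : 0 ≤ F.gsum Mᶜ M ∅ ∅ := by
    have := F.gsum_le_three_mul_oneLift Mᶜ M p hup; linarith
  have h2 : 0 ≤ F.gsum Mᶜ M M ∅ := F.gsum_twoLift_nonneg Mᶜ M p hup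
  have h3 : 0 ≤ F.gsum Mᶜ M M M := F.gsum_threeLift_nonneg Mᶜ M p hup
  refine F.ZKflip_nonneg_of_isModule hF D fun P => ?_
  unfold modCoefFlip
  rw [hDM, F.gsumFlip_empty]
  unfold glue
  by_cases a0 : (0 : Fin 3) ∈ P <;> by_cases a1 : (1 : Fin 3) ∈ P <;> by_cases a2 : (2 : Fin 3) ∈ P <;>
    simp only [a0, a1, a2, if_true, if_false]
  · exact h3
  · exact h2
  · rw [← F.gsum_swap23 Mᶜ M M ∅]; exact h2
  · exact h1
  · rw [F.gsum_swap12 Mᶜ ∅ M M, ← F.gsum_swap23 Mᶜ M M ∅]; exact h2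
  · rw [F.gsum_swap12 Mᶜ ∅ M ∅]; exact h1
  · rw [F.gsum_swap23 Mᶜ ∅ ∅ M, F.gsum_swap12 Mᶜ ∅ M ∅]; exact h1
  · exact h0

/-- The same with the hypothesis `lab M ≠ 0` (then every glued label is `lab M` or `⊤`). [this work] -/
theorem ZKflip_nonneg_of_isModule_of_lab_ne_zero_of_subset {M : Finset α} {g : Finset α → Bool} (hF : F.IsModule M g) (hM : F.lab M ≠ 0)
    {D : Finset α} (hD : D ⊆ M) (h0 : 0 ≤ F.gsum Mᶜ ∅ ∅ ∅) : 0 ≤ F.ZKflip D :=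
  F.ZKflip_nonneg_of_isModule_of_upper_of_subset hF (F.lab M) (fun X _ => F.lab_union_cases_of_lab_ne_zero M X hM) hD h0

/-- **Conjecture G for every flip set inside one tile of a structure tiled by non-bottom modules** (all θ_m-blow-ups, every `m`): if `univ` is a disjoint union of modules
`M i` (`i ∈ s`) with `lab (M i) ≠ 0` and `D ⊆ M i₀` for some `i₀ ∈ s`, then `0 ≤ ZKflip D` — in particular for every singleton `D = {e}`. [this work] -/
theorem ZKflip_nonneg_of_modules_cover_of_subset {ι : Type*} [DecidableEq ι] (s : Finset ι) (M : ι → Finset α) (g : ι → (Finset α → Bool))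
    (hmod : ∀ i ∈ s, F.IsModule (M i) (g i)) (hlab : ∀ i ∈ s, F.lab (M i) ≠ 0)
    (hdisj : ∀ i ∈ s, ∀ j ∈ s, i ≠ j → Disjoint (M i) (M j)) (hcov : s.biUnion M = univ)
    {i₀ : ι} (hi₀ : i₀ ∈ s) {D : Finset α} (hD : D ⊆ M i₀) : 0 ≤ F.ZKflip D := by
  refine F.ZKflip_nonneg_of_isModule_of_lab_ne_zero_of_subset (hmod i₀ hi₀) (hlab i₀ hi₀) hD ?_
  -- the deletion window `(M i₀)ᶜ` is the union of the other tiles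
  have hW : (M i₀)ᶜ = (s.erase i₀).biUnion M := by
    have hd : Disjoint (M i₀) ((s.erase i₀).biUnion M) := by
      rw [disjoint_biUnion_right]
      intro j hj
      exact hdisj i₀ hi₀ j (mem_of_mem_erase hj) (ne_of_mem_erase hj).symm
    have hsplit : s.biUnion M = M i₀ ∪ (s.erase i₀).biUnion M := by rw [← biUnion_insert, insert_erase hi₀]
    rw [compl_eq_univ_sdiff, ← hcov, hsplit, union_sdiff_left, Finset.sdiff_eq_self_iff_disjoint]
    exact hd.symm
  rw [hW]
  exact F.gsum_biUnion_nonneg_of_modules (s.erase i₀) M g (fun j hj => hmod j (mem_of_mem_erase hj)) (fun j hj => hlab j (mem_of_mem_erase hj))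
    (fun j hj j' hj' hne => hdisj j (mem_of_mem_erase hj) j' (mem_of_mem_erase hj') hne)

/-- In particular: **`0 ≤ ZKflip {e}` for EVERY coordinate `e`** of a structure tiled by non-bottom modules. [this work] -/
theorem ZKflip_singleton_nonneg_of_modules_cover {ι : Type*} [DecidableEq ι] (s : Finset ι) (M : ι → Finset α) (g : ι → (Finset α → Bool))
    (hmod : ∀ i ∈ s, F.IsModule (M i) (g i)) (hlab : ∀ i ∈ s, F.lab (M i) ≠ 0)
    (hdisj : ∀ i ∈ s, ∀ j ∈ s, i ≠ j → Disjoint (M i) (M j)) (hcov : s.biUnion M = univ) (e : α) : 0 ≤ F.ZKflip {e} := by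
  have he : e ∈ s.biUnion M := by rw [hcov]; exact mem_univ e
  obtain ⟨i₀, hi₀, hei⟩ := mem_biUnion.1 he
  exact F.ZKflip_nonneg_of_modules_cover_of_subset s M g hmod hlab hdisj hcov hi₀ (singleton_subset_iff.2 hei)

end MSunflower

end Summit.CriticalPhenomena.PercolationContinuityZ3.Theorems.SunflowerPartition
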